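import Summits.QuantumFields.BalabanUV.Beta.GAN24.CombRelSourceHalf
import Summits.QuantumFields.BalabanUV.Beta.GAN24.WSlotFirstDiff
import Summits.QuantumFields.BalabanUV.Beta.GAN24.ZeroModeParity
import Summits.QuantumFields.BalabanUV.Beta.GAN24.TableDressingDefect

/-!
# `BalabanUV.Beta.GAN24.CombRelSourceHalfCharge` — binder row G-an2-4 ∕ (CONV-C), TRANSFER-III (the (α-0) chain at row D1's literal of record (III′)), PART 2 of
# `CombRelSourceHalf`: **THE (C)^{ε} ⟸ (C) BRIDGE AT THE COMB-CHART SLOT DATA — the OWNER's T4 ∕ T5 displayed row `hZ` (the `ZfreeSym` antisymmetry of the comb-chart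
# `ε`-member's relative source `b′^{rel,ε}_l`) FOLLOWS FROM ROW (C) IN ITS R-HYB′ FORM (`ZfreeSym` of the FULL comb-chart member's relative source
# `b′_l = T̃′♮_{l+1} − 𝒜^K_l T̃′♮_l`), FOR EVERY `ε`** — MY lineage's (E) file `RelSourceHalfCharge` (gen 72; in the (α-0) END's import closure via leaf-02's `RowCChargeForms`)
# RE-RUN at `(GcombSh Lc ·, SpureCombOf tabs, tabs.M, tabs.vh₂S, tabs.mixFF)`; PART 1's `relSource_comb_half_eq` ⨾ the OWNER gan24-p1's table-generic
# `ZeroModeParity.zsym_halfTable`, with `b′_l`'s `LocStencil₂` class supplied per level (§0–§1)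
# (G-an2-4 CRUX TEAM (2), leaf prover `b2b-balaban-gan24-formalise-leaf-01`, gen 80; the OWNER gan24-p1 g46's (III′) link table R-gan24p1-g46-2, row «L8b–L9»; no existing file touched)

NOT IN PRINT; OUR BOOKKEEPING ([folklore] composition BY NAME; statements = MY (E) file's with `(coDressKBmAt ρ Lc (KInvStep Lc ·), T2RecAt ρ, SpureRecAt ρ, M1At ρ cΛ, vh₂S,
mixFFAt ρ Lc) ↦ (GcombSh Lc ·, T2RecOf … (GcombSh Lc) (SpureCombOf tabs …) tabs.M …, SpureCombOf tabs, tabs.M, tabs.vh₂S, tabs.mixFF)`, root binders `hLc hr` and the border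
class `hB` ↦ the record `tabs : SymTables d Lc`; proofs token for token; 0 `def`, 0 cited facts, 0 `def … : Prop`, 0 sorry).  HONEST FRAMING (cell contract, verbatim):
«discharging `BetaPertH` makes Bałaban's UV stability UNCONDITIONAL — a real constructive-QFT result; it is NOT the continuum limit and NOT the Clay problem.»  HONEST
DEPENDENCY (verbatim): «continuum YM on T⁴ ⇐ BetaPertH ∧ nine spine estimates (0/9 proved); BetaPertH ⇐ (D1) ∧ (D4) ∧ CAP+tail; G-an2-4 gates asym, D1 and NE2/3/4.»

WHAT (any record `tabs : SymTables d Lc` with off-diagonal border `hBff hBmm`; generic `d`, `Lc ≥ 1` via `[NeZero Lc]`; `T̃′♮_j := unitS₂_j (T2RecOf d Lc (GcombSh Lc) (SpureCombOf tabs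
cE cVH cΛ) tabs.M cE₂ cB Tc tabs.vh₂S tabs.mixFF j)`, `K♮_l := unitK_l (KInvStep Lc l)`, `c₄ := cE₂·Lc^{2(d+1)}`):
* §0 `locStencil₂_unitS₂_T2RecOf_comb` — EVERY comb-chart unit member `T̃′♮_j` is `LocStencil₂` at a positive rate (an2's slot letter `SpineRooted.T2RecOf_loc` with the record's
  letters (DG′)(LS′)(LM)(LB)(Lmix) ⨾ `WSlotFirstDiff.locStencil₂_unitS₂`) — the (III′) twin of `T2RecChargeStep.shape_member` (the OWNER's T4 §1 is its level-`0` case with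
  explicit constants).
* §1 `locStencil₂_relSource_comb` — `b′_l := T̃′♮_{l+1} − 𝒜^K_l T̃′♮_l` is `LocStencil₂` at a positive rate (§0 at `l+1`; `Lin4ZeroMode.locStencil₂_lin4` on §0 at `l` through
  the decaying undressed unit step; `LocStencil₂.mono`; leaf-06's `locStencil₂_diff`).
* §2 **`zsym_relSource_comb_half`** — ROW (C) (R-HYB′ form, every level) ⟹ the `hZ` row of the `ε`-member's relative source `½ • (b̃′♮_l + ε • P b̃′♮_l) + (𝒜^{G′}_l y_l −
  𝒜^K_l y_l)`, for every `ε` (PART 1 `relSource_comb_half_eq` ⨾ `zsym_halfTable`).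
WHAT THIS IS NOT.  Row (C) at the comb data is a DISPLAYED HYPOTHESIS (its (III′) instance is leaf-02's `RowCChargeForms` twin ∕ road-P2's (C) ledger at `GcombSh` — «NOBODY today»,
R-2 row L10); NOT one row of the S-∕W-slot, NO value; asserts NOTHING about Bałaban's tables; the (III′) campaign is NOT asked (an2 W-4 l.64553) — zero weight; NEVER «G-an2-4
closed» as (CONV-C); NOT D1, NOT `BetaPertH`, NOT continuum, NOT Clay.  2026-08-25.
-/

noncomputable section

open Finset
open scoped BigOperators
open Literature.MathematicalPhysics.QuantumFieldTheory
open Literature.MathematicalPhysics.QuantumFieldTheory.Balaban1983to89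
open Literature.MathematicalPhysics.QuantumFieldTheory.Balaban1983to89.Beta
open ExpKernelCalculus (MKer Decays)
open OneStepResolventKernel (Fib)
open OneStepKernelFamily (KInvStep decays_KInvStep)
open SecondOrderResponse (W2SymOfK)
open BalabanStepJetsSucc (mmRead)
open BalabanStepW2 (K3OfK M2Of)
open AffineAveraging (box toSite)
open BalabanCompositeJets (LocStencil₂)
open Summit.QuantumFields.BalabanUV.Beta.TameKernelCalculus (trK)
open Summit.QuantumFields.BalabanUV.Beta.BorderedHessian (sgnK)
open Summit.QuantumFields.BalabanUV.Beta.HessKerDressedUnits (unitK unitS decays_unitK)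
open Summit.QuantumFields.BalabanUV.Beta.SecondOrderUnits (unitM unitS₂ unitM₂)
open Summit.QuantumFields.BalabanUV.Beta.SpineRooted (T2RecOf T2RecOf_loc)
open Summit.QuantumFields.BalabanUV.Beta.SymmetrisedStepJets (SymTables)
open Summit.QuantumFields.BalabanUV.Beta.CombChartStepJets (GcombSh decays_GcombSh SpureCombOf locStencil_SpureCombOf)
open Summit.QuantumFields.BalabanUV.Beta.GAN24.CombesThomas (sfStep smStep)
open Summit.QuantumFields.BalabanUV.Beta.GAN24.T2RecursionAffine (lin4)
open Summit.QuantumFields.BalabanUV.Beta.GAN24.BiStencilZeroMode (Tab zmode)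
open Summit.QuantumFields.BalabanUV.Beta.GAN24.WSlotFirstDiff (locStencil₂_unitS₂)
open Summit.QuantumFields.BalabanUV.Beta.GAN24.Lin4ZeroMode (locStencil₂_lin4)
open Summit.QuantumFields.BalabanUV.Beta.GAN24.TableDressingDefect (locStencil₂_diff)
open Summit.QuantumFields.BalabanUV.Beta.GAN24.ZeroModeParity (zsym_halfTable)
open Summit.QuantumFields.BalabanUV.Beta.GAN24.CombRelSourceHalf (relSource_comb_half_eq)

namespace Summit.QuantumFields.BalabanUV.Beta.GAN24.CombRelSourceHalfCharge

variable {d : ℕ} {Lc : ℕ} [NeZero Lc]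

/-! ## §0 Every comb-chart unit member is `LocStencil₂` at a positive rate -/

/-- [folklore] **EVERY COMB-CHART UNIT MEMBER `T̃′♮_j` IS `LocStencil₂` AT A POSITIVE RATE** (an2's slot letter `T2RecOf_loc` with the record's letters — an2's `decays_GcombSh` ∕
`locStencil_SpureCombOf`, `tabs.hM ∕ hB ∕ hmix` — then `locStencil₂_unitS₂`) — the (III′) twin of `T2RecChargeStep.shape_member`. -/
theorem locStencil₂_unitS₂_T2RecOf_comb (tabs : SymTables d Lc) (cE cVH cΛ cE₂ cB : ℝ) (Tc : Fin 4 → Fin 4 → Fin 4 → Fin 4 → ℝ) (j : ℕ) :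
    ∃ CT δT : ℝ, 0 < δT ∧ LocStencil₂ (unitS₂ (sfStep Lc j) (smStep d Lc j)
      (T2RecOf d Lc (GcombSh Lc) (SpureCombOf tabs cE cVH cΛ) tabs.M cE₂ cB Tc tabs.vh₂S tabs.mixFF j)) CT δT := by
  obtain ⟨C, δ, hδ, h⟩ := T2RecOf_loc cE₂ cB Tc tabs.vh₂S tabs.mixFF NeZero.one_le (decays_GcombSh (d := d) Lc)
    (locStencil_SpureCombOf tabs cE cVH cΛ) tabs.hM tabs.hB tabs.hmix j
  exact ⟨_, δ, hδ, locStencil₂_unitS₂ (sfStep Lc j) (smStep d Lc j) h⟩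

/-! ## §1 The full comb-chart member's relative source is `LocStencil₂` at a positive rate -/

/-- [folklore] **`b′_l := T̃′♮_{l+1} − 𝒜^K_l T̃′♮_l` IS `LocStencil₂` AT A POSITIVE RATE** (per level; §0 at `l+1`, `locStencil₂_lin4` on §0 at `l` through the
decaying undressed unit step, both classes taken to the common rate by `LocStencil₂.mono`, then `locStencil₂_diff`).  The twin of MY g72 `RelSourceHalfCharge.locStencil₂_relSource`. -/
theorem locStencil₂_relSource_comb (tabs : SymTables d Lc) (cE cVH cΛ cE₂ cB : ℝ) (Tc : Fin 4 → Fin 4 → Fin 4 → Fin 4 → ℝ)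
    (l : ℕ) :
    ∃ C δ : ℝ, 0 < δ ∧ LocStencil₂ (unitS₂ (sfStep Lc (l + 1)) (smStep d Lc (l + 1)) (T2RecOf d Lc (GcombSh Lc) (SpureCombOf tabs cE cVH cΛ) tabs.M cE₂ cB Tc tabs.vh₂S tabs.mixFF (l + 1))
            - lin4 (cE₂ * (Lc : ℝ) ^ (2 * (d + 1))) (unitK (sfStep Lc l) (smStep d Lc l) (KInvStep (d := d) Lc l)) Lc
              (unitS₂ (sfStep Lc l) (smStep d Lc l) (T2RecOf d Lc (GcombSh Lc) (SpureCombOf tabs cE cVH cΛ) tabs.M cE₂ cB Tc tabs.vh₂S tabs.mixFF l))) C δ := by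
  obtain ⟨C₁, δ₁, hδ₁, h₁⟩ := locStencil₂_unitS₂_T2RecOf_comb tabs cE cVH cΛ cE₂ cB Tc (l + 1)
  obtain ⟨C₀, δ₀, hδ₀, h₀⟩ := locStencil₂_unitS₂_T2RecOf_comb tabs cE cVH cΛ cE₂ cB Tc l
  obtain ⟨δK, CK, hδK, hCK, hK⟩ := decays_KInvStep (d := d) (Lc := Lc) l
  have h₂ := locStencil₂_lin4 (decays_unitK (sf := sfStep Lc l) (sm := smStep d Lc l) hK)
    (mul_nonneg (mul_nonneg ((abs_nonneg _).trans (le_max_left _ _)) hCK) ((abs_nonneg _).trans (le_max_left _ _)))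
    hδK (NeZero.one_le (n := Lc)) (cE₂ * (Lc : ℝ) ^ (2 * (d + 1))) h₀ hδ₀
  exact ⟨_, min δ₁ (min δK δ₀ / 128), lt_min hδ₁ (by positivity),
    locStencil₂_diff (h₁.mono (min_le_left _ _)) (h₂.mono (min_le_right _ _))⟩

/-! ## §2 The (C)^{ε} ⟸ (C) bridge -/

/-- NOT IN PRINT; OUR BOOKKEEPING.  **ROW (C) OF RECORD ⟹ THE END's `hC`, FOR EVERY `ε`**: if the full member's relative source `b′_l` is `ZfreeSym` (bond-antisymmetric ff
cell charge at period `Lc`) at every level, then so is the `ε`-member's relative source `b′^{rel,ε}_l = ½ • (b̃′♮_l + ε • P b̃′♮_l) + (𝒜^{G′}_l y_l − 𝒜^K_l y_l)` — PART 1's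
`CombRelSourceHalf.relSource_comb_half_eq` rewrites it as `½ • (b′_l + ε • P b′_l)`, the OWNER's `ZeroModeParity.zsym_halfTable` passes the row to the `ε`-half (§1 for the class). -/
theorem zsym_relSource_comb_half (tabs : SymTables d Lc) (cE cVH cΛ cE₂ cB : ℝ) (Tc : Fin 4 → Fin 4 → Fin 4 → Fin 4 → ℝ)
    (hBff : ∀ κ u κ' u' x z (α β : Fin (d + 1)), tabs.vh₂S κ u κ' u' x z (Sum.inl α) (Sum.inl β) = 0)
    (hBmm : ∀ κ u κ' u' x z (μ ν : Fin (d + 1)), tabs.vh₂S κ u κ' u' x z (Sum.inr μ) (Sum.inr ν) = 0) (ε : ℝ)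
    (hC : ∀ (l : ℕ) (κ κ' κ₁ κ₂ : Fin (d + 1)),
      zmode Lc ((unitS₂ (sfStep Lc (l + 1)) (smStep d Lc (l + 1)) (T2RecOf d Lc (GcombSh Lc) (SpureCombOf tabs cE cVH cΛ) tabs.M cE₂ cB Tc tabs.vh₂S tabs.mixFF (l + 1))
            - lin4 (cE₂ * (Lc : ℝ) ^ (2 * (d + 1))) (unitK (sfStep Lc l) (smStep d Lc l) (KInvStep (d := d) Lc l)) Lc
              (unitS₂ (sfStep Lc l) (smStep d Lc l) (T2RecOf d Lc (GcombSh Lc) (SpureCombOf tabs cE cVH cΛ) tabs.M cE₂ cB Tc tabs.vh₂S tabs.mixFF l)))) κ κ' (Sum.inl κ₁) (Sum.inl κ₂)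
        + zmode Lc ((unitS₂ (sfStep Lc (l + 1)) (smStep d Lc (l + 1)) (T2RecOf d Lc (GcombSh Lc) (SpureCombOf tabs cE cVH cΛ) tabs.M cE₂ cB Tc tabs.vh₂S tabs.mixFF (l + 1))
            - lin4 (cE₂ * (Lc : ℝ) ^ (2 * (d + 1))) (unitK (sfStep Lc l) (smStep d Lc l) (KInvStep (d := d) Lc l)) Lc
              (unitS₂ (sfStep Lc l) (smStep d Lc l) (T2RecOf d Lc (GcombSh Lc) (SpureCombOf tabs cE cVH cΛ) tabs.M cE₂ cB Tc tabs.vh₂S tabs.mixFF l)))) κ' κ (Sum.inl κ₁) (Sum.inl κ₂) = 0)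
    (l : ℕ) (κ κ' κ₁ κ₂ : Fin (d + 1)) :
    zmode Lc (((1 / 2 : ℝ) • ((fun κ u κ' u' => (cE₂ * (Lc : ℝ) ^ (2 * (d + 1))) • mmRead Lc (K3OfK
            (unitK (sfStep Lc l) (smStep d Lc l) (GcombSh (d := d) Lc l)) Lc
            (unitS (sfStep Lc l) (smStep d Lc l) (SpureCombOf tabs cE cVH cΛ l)) (unitM (sfStep Lc l) (smStep d Lc l) (tabs.M l))
            (W2SymOfK (unitK (sfStep Lc l) (smStep d Lc l) (GcombSh (d := d) Lc l)) Lc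
              (unitS (sfStep Lc l) (smStep d Lc l) (SpureCombOf tabs cE cVH cΛ l)) (unitM (sfStep Lc l) (smStep d Lc l) (tabs.M l)) 0
              (unitM₂ (sfStep Lc l) (smStep d Lc l) (M2Of d Lc tabs.mixFF l))) κ u κ' u') + cB • tabs.vh₂S κ u κ' u')
          + ε • fun κ u κ' u' => sgnK (trK ((fun κ u κ' u' => (cE₂ * (Lc : ℝ) ^ (2 * (d + 1))) • mmRead Lc (K3OfK
            (unitK (sfStep Lc l) (smStep d Lc l) (GcombSh (d := d) Lc l)) Lc
            (unitS (sfStep Lc l) (smStep d Lc l) (SpureCombOf tabs cE cVH cΛ l)) (unitM (sfStep Lc l) (smStep d Lc l) (tabs.M l))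
            (W2SymOfK (unitK (sfStep Lc l) (smStep d Lc l) (GcombSh (d := d) Lc l)) Lc
              (unitS (sfStep Lc l) (smStep d Lc l) (SpureCombOf tabs cE cVH cΛ l)) (unitM (sfStep Lc l) (smStep d Lc l) (tabs.M l)) 0
              (unitM₂ (sfStep Lc l) (smStep d Lc l) (M2Of d Lc tabs.mixFF l))) κ u κ' u') + cB • tabs.vh₂S κ u κ' u') κ u κ' u'))))
        + (lin4 (cE₂ * (Lc : ℝ) ^ (2 * (d + 1))) (unitK (sfStep Lc l) (smStep d Lc l) (GcombSh (d := d) Lc l)) Lc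
              ((1 / 2 : ℝ) • (unitS₂ (sfStep Lc l) (smStep d Lc l) (T2RecOf d Lc (GcombSh Lc) (SpureCombOf tabs cE cVH cΛ) tabs.M cE₂ cB Tc tabs.vh₂S tabs.mixFF l)
          + ε • fun κ u κ' u' => sgnK (trK (unitS₂ (sfStep Lc l) (smStep d Lc l) (T2RecOf d Lc (GcombSh Lc) (SpureCombOf tabs cE cVH cΛ) tabs.M cE₂ cB Tc tabs.vh₂S tabs.mixFF l) κ u κ' u'))))
          - lin4 (cE₂ * (Lc : ℝ) ^ (2 * (d + 1))) (unitK (sfStep Lc l) (smStep d Lc l) (KInvStep (d := d) Lc l)) Lc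
              ((1 / 2 : ℝ) • (unitS₂ (sfStep Lc l) (smStep d Lc l) (T2RecOf d Lc (GcombSh Lc) (SpureCombOf tabs cE cVH cΛ) tabs.M cE₂ cB Tc tabs.vh₂S tabs.mixFF l)
          + ε • fun κ u κ' u' => sgnK (trK (unitS₂ (sfStep Lc l) (smStep d Lc l) (T2RecOf d Lc (GcombSh Lc) (SpureCombOf tabs cE cVH cΛ) tabs.M cE₂ cB Tc tabs.vh₂S tabs.mixFF l) κ u κ' u')))))) κ κ' (Sum.inl κ₁) (Sum.inl κ₂)
      + zmode Lc (((1 / 2 : ℝ) • ((fun κ u κ' u' => (cE₂ * (Lc : ℝ) ^ (2 * (d + 1))) • mmRead Lc (K3OfK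
            (unitK (sfStep Lc l) (smStep d Lc l) (GcombSh (d := d) Lc l)) Lc
            (unitS (sfStep Lc l) (smStep d Lc l) (SpureCombOf tabs cE cVH cΛ l)) (unitM (sfStep Lc l) (smStep d Lc l) (tabs.M l))
            (W2SymOfK (unitK (sfStep Lc l) (smStep d Lc l) (GcombSh (d := d) Lc l)) Lc
              (unitS (sfStep Lc l) (smStep d Lc l) (SpureCombOf tabs cE cVH cΛ l)) (unitM (sfStep Lc l) (smStep d Lc l) (tabs.M l)) 0
              (unitM₂ (sfStep Lc l) (smStep d Lc l) (M2Of d Lc tabs.mixFF l))) κ u κ' u') + cB • tabs.vh₂S κ u κ' u')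
          + ε • fun κ u κ' u' => sgnK (trK ((fun κ u κ' u' => (cE₂ * (Lc : ℝ) ^ (2 * (d + 1))) • mmRead Lc (K3OfK
            (unitK (sfStep Lc l) (smStep d Lc l) (GcombSh (d := d) Lc l)) Lc
            (unitS (sfStep Lc l) (smStep d Lc l) (SpureCombOf tabs cE cVH cΛ l)) (unitM (sfStep Lc l) (smStep d Lc l) (tabs.M l))
            (W2SymOfK (unitK (sfStep Lc l) (smStep d Lc l) (GcombSh (d := d) Lc l)) Lc
              (unitS (sfStep Lc l) (smStep d Lc l) (SpureCombOf tabs cE cVH cΛ l)) (unitM (sfStep Lc l) (smStep d Lc l) (tabs.M l)) 0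
              (unitM₂ (sfStep Lc l) (smStep d Lc l) (M2Of d Lc tabs.mixFF l))) κ u κ' u') + cB • tabs.vh₂S κ u κ' u') κ u κ' u'))))
        + (lin4 (cE₂ * (Lc : ℝ) ^ (2 * (d + 1))) (unitK (sfStep Lc l) (smStep d Lc l) (GcombSh (d := d) Lc l)) Lc
              ((1 / 2 : ℝ) • (unitS₂ (sfStep Lc l) (smStep d Lc l) (T2RecOf d Lc (GcombSh Lc) (SpureCombOf tabs cE cVH cΛ) tabs.M cE₂ cB Tc tabs.vh₂S tabs.mixFF l)
          + ε • fun κ u κ' u' => sgnK (trK (unitS₂ (sfStep Lc l) (smStep d Lc l) (T2RecOf d Lc (GcombSh Lc) (SpureCombOf tabs cE cVH cΛ) tabs.M cE₂ cB Tc tabs.vh₂S tabs.mixFF l) κ u κ' u'))))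
          - lin4 (cE₂ * (Lc : ℝ) ^ (2 * (d + 1))) (unitK (sfStep Lc l) (smStep d Lc l) (KInvStep (d := d) Lc l)) Lc
              ((1 / 2 : ℝ) • (unitS₂ (sfStep Lc l) (smStep d Lc l) (T2RecOf d Lc (GcombSh Lc) (SpureCombOf tabs cE cVH cΛ) tabs.M cE₂ cB Tc tabs.vh₂S tabs.mixFF l)
          + ε • fun κ u κ' u' => sgnK (trK (unitS₂ (sfStep Lc l) (smStep d Lc l) (T2RecOf d Lc (GcombSh Lc) (SpureCombOf tabs cE cVH cΛ) tabs.M cE₂ cB Tc tabs.vh₂S tabs.mixFF l) κ u κ' u')))))) κ' κ (Sum.inl κ₁) (Sum.inl κ₂) = 0 := by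
  obtain ⟨C, δ, hδ, hrel⟩ := locStencil₂_relSource_comb tabs cE cVH cΛ cE₂ cB Tc l
  rw [relSource_comb_half_eq tabs cE cVH cΛ cE₂ cB Tc hBff hBmm ε l]
  exact zsym_halfTable hrel hδ (hC l) (1 / 2 : ℝ) ε κ κ' κ₁ κ₂

end Summit.QuantumFields.BalabanUV.Beta.GAN24.CombRelSourceHalfCharge

end
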